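import Summits.KontsevichZagierPeriods.KontsevichZagierPeriods.Theses.IsogenyCertificates

/-!
# `XMapPeriodTransfer` (stmt-KontsevichZagierPeriods-10665), line `saturated-sign-cells` — stub `stub_cubicComponents`

Structure of the positivity set `S = {y : ℝ | 0 < y³ + Ay + B}` of a real depressed cubic
`P = X³ + AX + B`: with `M = 1 + |A| + |B|` and `U = connectedComponentIn S M` the UNBOUNDED
component of `S`,

* an interval `(u, ∞) ⊆ S` starting at a root `u` of `P` IS `U`;
* an interval `(u, v) ⊆ S` between two roots `u < v` of `P` IS the EGG `S ∖ U`.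

The proof is elementary root counting for a monic real cubic: three distinct real roots `t, u, v`
force `P = (X - t)(X - u)(X - v)` identically, which pins down the sign of `P` between and beyond
the roots; the remaining steps are the intermediate value theorem and order-connectedness of
preconnected subsets of `ℝ`.

References: M. Kontsevich, D. Zagier, *Periods* (2001), §1.2 (the calculus this line serves);
the content of this file is folklore real algebra.
-/

noncomputable section

open Set Filter MeasureTheory Polynomial Topology

namespace Summit.KontsevichZagierPeriods.IsogenyCertificates.XMapPeriodTransferCells

/-- Three distinct real roots `t, u, v` of the depressed cubic `X³ + aX + b` factor it:
`x³ + ax + b = (x - t)(x - u)(x - v)` for every `x`. [folklore] -/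
theorem cubicComponents_eq_prod_of_three_roots {a b t u v : ℝ} (ht : t ^ 3 + a * t + b = 0)
    (hu : u ^ 3 + a * u + b = 0) (hv : v ^ 3 + a * v + b = 0) (htu : t ≠ u) (huv : u ≠ v)
    (htv : t ≠ v) (x : ℝ) : x ^ 3 + a * x + b = (x - t) * (x - u) * (x - v) := by
  have h1 : t ^ 2 + t * u + u ^ 2 + a = 0 := by
    have h : (t - u) * (t ^ 2 + t * u + u ^ 2 + a) = 0 := by linear_combination ht - hu
    rcases mul_eq_zero.mp h with h | h
    · exact absurd (sub_eq_zero.mp h) htu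
    · exact h
  have h2 : u ^ 2 + u * v + v ^ 2 + a = 0 := by
    have h : (u - v) * (u ^ 2 + u * v + v ^ 2 + a) = 0 := by linear_combination hu - hv
    rcases mul_eq_zero.mp h with h | h
    · exact absurd (sub_eq_zero.mp h) huv
    · exact h
  have h3 : t + u + v = 0 := by
    have h : (t - v) * (t + u + v) = 0 := by linear_combination h1 - h2
    rcases mul_eq_zero.mp h with h | h
    · exact absurd (sub_eq_zero.mp h) htv
    · exact h
  linear_combination ht + (x - t) * h1 + (x ^ 2 - (t + u) * x + t * u) * h3

/-- Two-sided growth of the depressed cubic: `P(z) > 0` and `P(-z) < 0` for every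
`z ≥ 1 + |A| + |B|` (the one-sided bound is `cubic_pos_of_large_le` of the line's basic API;
restated here two-sidedly to keep this file independent of it). [folklore] -/
theorem cubicComponents_sign_of_large_le (A B : ℤ) {z : ℝ} (hz : 1 + |(A : ℝ)| + |(B : ℝ)| ≤ z) :
    0 < z ^ 3 + (A : ℝ) * z + (B : ℝ) ∧ (-z) ^ 3 + (A : ℝ) * (-z) + (B : ℝ) < 0 := by
  have hA : -|(A : ℝ)| ≤ (A : ℝ) := neg_abs_le _
  have hA' : (A : ℝ) ≤ |(A : ℝ)| := le_abs_self _
  have hB : -|(B : ℝ)| ≤ (B : ℝ) := neg_abs_le _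
  have hB' : (B : ℝ) ≤ |(B : ℝ)| := le_abs_self _
  have h0A : 0 ≤ |(A : ℝ)| := abs_nonneg _
  have h0B : 0 ≤ |(B : ℝ)| := abs_nonneg _
  have hz1 : 1 ≤ z := by linarith
  have hz0 : 0 ≤ z := by linarith
  constructor
  · nlinarith [mul_le_mul_of_nonneg_left hA hz0, sq_nonneg z, mul_le_mul_of_nonneg_left hz1 hz0,
      mul_le_mul_of_nonneg_left hz hz0, mul_nonneg hz0 h0B]
  · nlinarith [mul_le_mul_of_nonneg_left hA' hz0, sq_nonneg z, mul_le_mul_of_nonneg_left hz1 hz0,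
      mul_le_mul_of_nonneg_left hz hz0, mul_nonneg hz0 h0B]

/-- `P(z) < 0` for every `z ≤ -(1 + |A| + |B|)`. [folklore] -/
theorem cubicComponents_neg_of_le_neg_large (A B : ℤ) {z : ℝ}
    (hz : z ≤ -(1 + |(A : ℝ)| + |(B : ℝ)|)) : z ^ 3 + (A : ℝ) * z + (B : ℝ) < 0 := by
  have h := (cubicComponents_sign_of_large_le A B (z := -z) (by linarith)).2
  rwa [neg_neg] at h

/-- Every real root of `X³ + AX + B` is `< 1 + |A| + |B|`. [folklore] -/
theorem cubicComponents_root_lt_large (A B : ℤ) {w : ℝ} (hw : w ^ 3 + (A : ℝ) * w + (B : ℝ) = 0) :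
    w < 1 + |(A : ℝ)| + |(B : ℝ)| := by
  by_contra h
  have := (cubicComponents_sign_of_large_le A B (not_lt.mp h)).1
  linarith

/-- Below any point where `P > 0` there is a real root of `P`. [folklore] -/
theorem cubicComponents_exists_root_lt (A B : ℤ) {y : ℝ} (hy : 0 < y ^ 3 + (A : ℝ) * y + (B : ℝ)) :
    ∃ t < y, t ^ 3 + (A : ℝ) * t + (B : ℝ) = 0 := by
  have hcont : Continuous fun x : ℝ => x ^ 3 + (A : ℝ) * x + (B : ℝ) := by fun_prop
  have h0 : 0 ≤ 1 + |(A : ℝ)| + |(B : ℝ)| := by positivity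
  have hz₀y : -(1 + |(A : ℝ)| + |(B : ℝ)| + |y|) ≤ y := by
    have := neg_abs_le y
    linarith
  have hPz₀ : (-(1 + |(A : ℝ)| + |(B : ℝ)| + |y|)) ^ 3 + (A : ℝ) * (-(1 + |(A : ℝ)| + |(B : ℝ)| + |y|))
      + (B : ℝ) < 0 :=
    cubicComponents_neg_of_le_neg_large A B (by have := abs_nonneg y; linarith)
  obtain ⟨t, ht, hPt⟩ := intermediate_value_Icc hz₀y hcont.continuousOn ⟨hPz₀.le, hy.le⟩
  refine ⟨t, lt_of_le_of_ne ht.2 ?_, hPt⟩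
  rintro rfl
  simp only at hPt
  linarith

/-- **Registered stub `stub_cubicComponents`** of the line's skeleton (Cruxes/XMapPeriodTransfer/
Lines/saturated-sign-cells.lean): with `S = {P > 0}`, `U = connectedComponentIn S (1 + |A| + |B|)`,
an interval `(u, ∞) ⊆ S` at a root `u` equals `U`, and an interval `(u, v) ⊆ S` between roots
`u < v` equals the egg `S ∖ U`. (The discriminant hypothesis is not used.) [folklore] -/
theorem stub_cubicComponents : ∀ (A B : ℤ), 4 * A ^ 3 + 27 * B ^ 2 ≠ 0 →
    ∀ (U : Set ℝ), U = connectedComponentIn {y : ℝ | 0 < y ^ 3 + (A : ℝ) * y + (B : ℝ)}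
      (1 + |(A : ℝ)| + |(B : ℝ)|) →
    ∀ u : ℝ, u ^ 3 + (A : ℝ) * u + (B : ℝ) = 0 →
      (Ioi u ⊆ {y : ℝ | 0 < y ^ 3 + (A : ℝ) * y + (B : ℝ)} → Ioi u = U) ∧
      ∀ v : ℝ, v ^ 3 + (A : ℝ) * v + (B : ℝ) = 0 → u < v →
        Ioo u v ⊆ {y : ℝ | 0 < y ^ 3 + (A : ℝ) * y + (B : ℝ)} →
        Ioo u v = {y : ℝ | 0 < y ^ 3 + (A : ℝ) * y + (B : ℝ)} \ U := by
  intro A B _ U hU u hu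
  -- Basic facts about `U`.
  have hUS : U ⊆ {y : ℝ | 0 < y ^ 3 + (A : ℝ) * y + (B : ℝ)} := by
    rw [hU]; exact connectedComponentIn_subset _ _
  have hMU : 1 + |(A : ℝ)| + |(B : ℝ)| ∈ U := by
    rw [hU]; exact mem_connectedComponentIn (cubicComponents_sign_of_large_le A B le_rfl).1
  have hIciU : Ici (1 + |(A : ℝ)| + |(B : ℝ)|) ⊆ U := by
    rw [hU]
    exact isPreconnected_Ici.subset_connectedComponentIn self_mem_Ici
      fun _ hz => (cubicComponents_sign_of_large_le A B hz).1
  have hUpre : IsPreconnected U := by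
    rw [hU]; exact isPreconnected_connectedComponentIn
  have huM := cubicComponents_root_lt_large A B hu
  refine ⟨fun hIoi => ?_, fun v hv huv hIoo => ?_⟩
  · -- (1) `(u, ∞) ⊆ S` with `P u = 0` is the unbounded component.
    apply Subset.antisymm
    · rw [hU]
      exact isPreconnected_Ioi.subset_connectedComponentIn huM hIoi
    · intro y hy
      by_contra hyu
      rw [mem_Ioi, not_lt] at hyu
      have huU : u ∈ U := hUpre.Icc_subset hy hMU ⟨hyu, huM.le⟩
      have := hUS huU
      simp only [mem_setOf_eq] at this
      linarith
  · -- (2) `(u, v) ⊆ S` between two roots is the egg.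
    have hvM := cubicComponents_root_lt_large A B hv
    have hcont : Continuous fun x : ℝ => x ^ 3 + (A : ℝ) * x + (B : ℝ) := by fun_prop
    apply Subset.antisymm
    · intro y hy
      refine ⟨hIoo hy, fun hyU => ?_⟩
      have hvU : v ∈ U := hUpre.Icc_subset hyU hMU ⟨hy.2.le, hvM.le⟩
      have := hUS hvU
      simp only [mem_setOf_eq] at this
      linarith
    · rintro y ⟨hyS, hyU⟩
      simp only [mem_setOf_eq] at hyS
      refine ⟨?_, ?_⟩
      · -- `u < y`: otherwise a third root `t < y < u < v` makes `P < 0` on `(u, v)`.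
        by_contra hyu
        rw [not_lt] at hyu
        have hyu' : y < u := lt_of_le_of_ne hyu (by rintro rfl; linarith)
        obtain ⟨t, hty, hPt⟩ := cubicComponents_exists_root_lt A B hyS
        have htu : t < u := hty.trans hyu'
        have key := cubicComponents_eq_prod_of_three_roots hPt hu hv htu.ne huv.ne
          (htu.trans huv).ne ((u + v) / 2)
        have hm : (u + v) / 2 ∈ Ioo u v := ⟨by linarith, by linarith⟩
        have hPm := hIoo hm
        simp only [mem_setOf_eq] at hPm
        have h1 : 0 < ((u + v) / 2 - t) * ((u + v) / 2 - u) :=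
          mul_pos (by linarith) (by linarith)
        have h2 : ((u + v) / 2 - t) * ((u + v) / 2 - u) * ((u + v) / 2 - v) < 0 :=
          mul_neg_of_pos_of_neg h1 (by linarith)
        linarith
      · -- `y < v`: otherwise a third root `u < v < y < t` makes `P y < 0`.
        by_contra hyv
        rw [not_lt] at hyv
        have hyv' : v < y := lt_of_le_of_ne hyv (by rintro rfl; linarith)
        have hyM : y < 1 + |(A : ℝ)| + |(B : ℝ)| := by
          by_contra h
          exact hyU (hIciU (not_lt.mp h))
        -- Some point of `[y, M]` has `P ≤ 0`, else `[y, M] ⊆ U`.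
        have hz : ∃ z ∈ Icc y (1 + |(A : ℝ)| + |(B : ℝ)|), z ^ 3 + (A : ℝ) * z + (B : ℝ) ≤ 0 := by
          by_contra h
          push Not at h
          refine hyU ?_
          rw [hU]
          exact isPreconnected_Icc.subset_connectedComponentIn (right_mem_Icc.mpr hyM.le)
            (fun z hz => h z hz) (left_mem_Icc.mpr hyM.le)
        obtain ⟨z, hzI, hPz⟩ := hz
        obtain ⟨t, ht, hPt⟩ := intermediate_value_Icc' hzI.1 hcont.continuousOn ⟨hPz, hyS.le⟩
        simp only at hPt
        have hyt : y < t := lt_of_le_of_ne ht.1 (by rintro rfl; linarith)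
        have key := cubicComponents_eq_prod_of_three_roots hu hv hPt huv.ne (hyv'.trans hyt).ne
          (huv.trans (hyv'.trans hyt)).ne y
        have h1 : 0 < (y - u) * (y - v) := mul_pos (by linarith) (by linarith)
        have h2 : (y - u) * (y - v) * (y - t) < 0 := mul_neg_of_pos_of_neg h1 (by linarith)
        linarith

end Summit.KontsevichZagierPeriods.IsogenyCertificates.XMapPeriodTransferCells

end
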